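import Summits.Ventures.HSemireg.WedgeHankelGlue

/-!
# Venture HSemireg — THEOREM R-B in the wedge model (1/9)

HONEST FRAMING. Part of the Lean index of the computation cell `pub-hsemireg` (seat p3; Sunday enclosure of the
FORMULA-N kernel assets of seats th-7 / th-6, ENCLOSURE-PLAN-p3.md).  Finite-dimensional exterior algebra over a field ONLY:
no variety, no cohomology theory, no semiregularity map is constructed here; nothing here says that HC / HC_CM / HC_AV holds;
no Literature fact is declared or used.  The geometric DICTIONARY (why these ranks are the `HT`-side box ranks of the cell's
STRUCTURE.md §1 / theory/FORMULA-N.md) lives in theory/FORMULA-N-th7.md PART B §A.3 / §N and is NOT asserted in Lean.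

THEOREM R-B (FORMULA-N PART B §L.3 / §L.8; STRUCTURE D9, (F1) Weil-frame clause, C16) in the SIGN-FREE transposed wedge model — theory/th7/WeilRank.lean v3 sha256/16 7e5d6bad1a94e25a (th-7 g4, 18:46Z; ×2 farm th-2 g20 18:48:20Z); PART R/R2/R3 = l.1506–3436 on top of HankelRank v1 (= the tree's Wedge/WedgeHankel* files), VERBATIM up
to namespaces (`HSemiregWeil` ↦ `Summit.Ventures.HSemireg.Wedge.Weil`, which sees the wedge-model infrastructure `….Wedge` and opens `….Wedge.Hankel`), file 1 of 9.
MODEL: `N` pairs of generators `x_c`, `y_c`; the h-part `f = w_N(q)` (HankelRank); the «Weil vectors» `w₊ = E_{G₋}`, `w₋ = E_{G₊}` = the full monomials on the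
generator blocks of the last `N − p` / first `p` pairs (signature `(p, N − p)`; THEOREM R is `N = 2n`, `p = n`).  HEADLINES (files 5, 8, 9): `weilRank` /
`weilRank_nn` («rank(⌟v ∣ HT²) = (4 + ρ)·n² − 2n», `v = f + a w₊ + b w₋`, `ab ≠ 0`, `n ≥ 3`, ρ = rank H₂(q)), `ker_eq` (kernel = mixed 2-forms killing `f`),
`weilRank_deg` / `weilRank_nn_deg` (every degree `m`, `m + 1 ≤ N − p`), `weilRank_one` / `weilRank_nn_one` (one-sided, ε = 1).  No permutation sign is evaluated
(the pair symmetries act through `AlternatingMap.map_perm`; `sgn κ` is a unit).  This file: `Sp P` (span of the monomials with predicate `P`), disjointness / coordinate / projection lemmas.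
-/

open Module Set Set.powersetCard Summit.Ventures.HSemireg.Wedge.Hankel

namespace Summit.Ventures.HSemireg.Wedge.Weil

variable (K : Type*) [Field K]

section SpanInfra

variable {I : Type*} [LinearOrder I] [Fintype I]

/-- span of the basis monomials `E_s` with `P s`. -/
noncomputable def Sp (P : Finset I → Prop) : Submodule K (HT K I) :=
  Submodule.span K ((fun s => B K I s) '' {s | P s})

variable {K}

/-- a monomial satisfying `P` lies in `Sp P`. -/
lemma B_mem_Sp {P : Finset I → Prop} {s : Finset I} (hs : P s) : B K I s ∈ Sp K P :=
  Submodule.subset_span ⟨s, hs, rfl⟩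

/-- `Sp` is monotone in the predicate. -/
lemma Sp_mono {P Q : Finset I → Prop} (h : ∀ s, P s → Q s) : Sp K P ≤ Sp K Q := by
  apply Submodule.span_mono
  rintro _ ⟨s, hs, rfl⟩
  exact ⟨s, h s hs, rfl⟩

/-- `Hom D d` as an `Sp`. -/
lemma Hom_eq_Sp (D : Finset I) (d : ℕ) : Hom K I D d = Sp K (fun s => s ⊆ D ∧ s.card = d) := rfl

/-- `Alg D` as an `Sp`. -/
lemma Alg_eq_Sp (D : Finset I) : Alg K I D = Sp K (fun s => s ⊆ D) := rfl

/-- membership in `Sp P` is read off the coordinates. -/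
lemma mem_Sp_iff {P : Finset I → Prop} {v : HT K I} :
    v ∈ Sp K P ↔ ∀ t, (B K I).coord t v ≠ 0 → P t := by
  rw [Sp, Basis.mem_span_image]
  simp only [Set.subset_def, Finset.mem_coe, Finsupp.mem_support_iff, Set.mem_setOf_eq, Basis.coord_apply]

/-- coordinates of an element of `Sp P` vanish off `P`. -/
lemma coord_eq_zero_of_mem_Sp {P : Finset I → Prop} {v : HT K I} (hv : v ∈ Sp K P) {t : Finset I}
    (ht : ¬ P t) : (B K I).coord t v = 0 := by
  by_contra h
  exact ht ((mem_Sp_iff.mp hv) t h)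

/-- an element of `Sp P ∩ Sp Q` with `P`, `Q` disjoint is zero. -/
lemma eq_zero_of_mem_Sp_of_mem_Sp {P Q : Finset I → Prop} (hPQ : ∀ s, P s → ¬ Q s) {v : HT K I}
    (hP : v ∈ Sp K P) (hQ : v ∈ Sp K Q) : v = 0 := by
  apply (B K I).repr.injective
  rw [map_zero]
  ext t
  by_cases ht : P t
  · exact coord_eq_zero_of_mem_Sp hQ (hPQ t ht)
  · exact coord_eq_zero_of_mem_Sp hP ht

/-- `Sp P ⊓ Sp Q = ⊥` for disjoint predicates. -/
lemma Sp_inf_Sp_eq_bot {P Q : Finset I → Prop} (hPQ : ∀ s, P s → ¬ Q s) : Sp K P ⊓ Sp K Q = ⊥ := by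
  rw [Submodule.eq_bot_iff]
  rintro v ⟨hP, hQ⟩
  exact eq_zero_of_mem_Sp_of_mem_Sp hPQ hP hQ

/-- products of supported spans: `Sp P * Sp Q ⊆ Sp R` whenever disjoint unions of `P`- and `Q`-sets are `R`-sets. -/
lemma mul_mem_Sp {P Q R : Finset I → Prop} (h : ∀ s t, Disjoint s t → P s → Q t → R (s ∪ t))
    {v w : HT K I} (hv : v ∈ Sp K P) (hw : w ∈ Sp K Q) : v * w ∈ Sp K R := by
  induction hv, hw using Submodule.span_induction₂ with
  | mem_mem x y hx hy =>
    obtain ⟨a, ha, rfl⟩ := hx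
    obtain ⟨c, hc, rfl⟩ := hy
    rw [B_mul_B]
    by_cases hac : Disjoint a c
    · exact Submodule.smul_mem _ _ (B_mem_Sp (h a c hac ha hc))
    · rw [u_eq_zero K hac, zero_smul]; exact Submodule.zero_mem _
  | zero_left y _ => rw [zero_mul]; exact Submodule.zero_mem _
  | zero_right x _ => rw [mul_zero]; exact Submodule.zero_mem _
  | add_left x y z _ _ _ hx hy => rw [add_mul]; exact Submodule.add_mem _ hx hy
  | add_right x y z _ _ _ hx hy => rw [mul_add]; exact Submodule.add_mem _ hx hy
  | smul_left r x y _ _ hx => rw [smul_mul_assoc]; exact Submodule.smul_mem _ _ hx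
  | smul_right r x y _ _ hx => rw [mul_smul_comm]; exact Submodule.smul_mem _ _ hx

/-- `v * E_t = 0` when every `P`-set meets `t`. -/
lemma mul_B_eq_zero_of_mem_Sp {P : Finset I → Prop} {t : Finset I} (h : ∀ s, P s → ¬ Disjoint s t)
    {v : HT K I} (hv : v ∈ Sp K P) : v * B K I t = 0 := by
  have h1 : v * B K I t ∈ Sp K (fun _ => False) :=
    mul_mem_Sp (P := P) (Q := fun s => s = t) (R := fun _ => False)
      (fun s s' hd hs hs' => h s hs (hs' ▸ hd)) hv (B_mem_Sp rfl)
  have h2 : Sp K (fun _ : Finset I => False) = ⊥ := by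
    rw [Sp, Submodule.span_eq_bot]
    rintro _ ⟨s, hs, rfl⟩
    exact hs.elim
  rw [h2] at h1
  exact h1

/-- `E_t ∧ v = 0` when `t` meets every support in `P` and `v ∈ Sp P`. -/
lemma B_mul_eq_zero_of_mem_Sp {P : Finset I → Prop} {t : Finset I} (h : ∀ s, P s → ¬ Disjoint t s)
    {v : HT K I} (hv : v ∈ Sp K P) : B K I t * v = 0 := by
  have h1 : B K I t * v ∈ Sp K (fun _ => False) :=
    mul_mem_Sp (P := fun s => s = t) (Q := P) (R := fun _ => False)
      (fun s s' hd hs hs' => h s' hs' (hs ▸ hd)) (B_mem_Sp rfl) hv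
  have h2 : Sp K (fun _ : Finset I => False) = ⊥ := by
    rw [Sp, Submodule.span_eq_bot]
    rintro _ ⟨s, hs, rfl⟩
    exact hs.elim
  rw [h2] at h1
  exact h1

/-- the coordinate projection onto `Sp P`. -/
noncomputable def proj (P : Finset I → Prop) [DecidablePred P] : HT K I →ₗ[K] HT K I :=
  (B K I).constr K fun s => if P s then B K I s else 0

/-- the coordinate projection onto `Sp P` on a monomial. -/
lemma proj_B (P : Finset I → Prop) [DecidablePred P] (s : Finset I) :
    proj (K := K) P (B K I s) = if P s then B K I s else 0 := by
  rw [proj, Basis.constr_basis]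

/-- the projection lands in `Sp P`. -/
lemma proj_mem (P : Finset I → Prop) [DecidablePred P] (v : HT K I) : proj (K := K) P v ∈ Sp K P := by
  have hv : v ∈ Submodule.span K (Set.range (B K I)) := by rw [(B K I).span_eq]; exact Submodule.mem_top
  induction hv using Submodule.span_induction with
  | mem x hx =>
    obtain ⟨s, rfl⟩ := hx
    rw [proj_B]
    split_ifs with h
    · exact B_mem_Sp h
    · exact Submodule.zero_mem _
  | zero => rw [map_zero]; exact Submodule.zero_mem _
  | add x y _ _ hx hy => rw [map_add]; exact Submodule.add_mem _ hx hy
  | smul a x _ hx => rw [map_smul]; exact Submodule.smul_mem _ _ hx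

/-- `proj P` is the identity on `Sp Q` when `Q ⇒ P`. -/
lemma proj_eq_self {P Q : Finset I → Prop} [DecidablePred P] (hQP : ∀ s, Q s → P s) {v : HT K I}
    (hv : v ∈ Sp K Q) : proj (K := K) P v = v := by
  induction hv using Submodule.span_induction with
  | mem x hx =>
    obtain ⟨s, hs, rfl⟩ := hx
    rw [proj_B, if_pos (hQP s hs)]
  | zero => rw [map_zero]
  | add x y _ _ hx hy => rw [map_add, hx, hy]
  | smul a x _ hx => rw [map_smul, hx]

/-- `proj P` kills `Sp Q` when `Q ⇒ ¬P`. -/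
lemma proj_eq_zero {P Q : Finset I → Prop} [DecidablePred P] (hQP : ∀ s, Q s → ¬ P s) {v : HT K I}
    (hv : v ∈ Sp K Q) : proj (K := K) P v = 0 := by
  induction hv using Submodule.span_induction with
  | mem x hx =>
    obtain ⟨s, hs, rfl⟩ := hx
    rw [proj_B, if_neg (hQP s hs)]
  | zero => rw [map_zero]
  | add x y _ _ hx hy => rw [map_add, hx, hy, add_zero]
  | smul a x _ hx => rw [map_smul, hx, smul_zero]

/-- the complementary projection: `proj (¬P)` maps `Sp Q` into `Sp (Q ∧ ¬P)`, and `v = proj P v + proj ¬P v`. -/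
lemma proj_add_proj_not (P : Finset I → Prop) [DecidablePred P] (v : HT K I) :
    proj (K := K) P v + proj (K := K) (fun s => ¬ P s) v = v := by
  have hv : v ∈ Submodule.span K (Set.range (B K I)) := by rw [(B K I).span_eq]; exact Submodule.mem_top
  induction hv using Submodule.span_induction with
  | mem x hx =>
    obtain ⟨s, rfl⟩ := hx
    rw [proj_B, proj_B]
    by_cases h : P s
    · rw [if_pos h, if_neg (not_not.mpr h), add_zero]
    · rw [if_neg h, if_pos h, zero_add]
  | zero => simp
  | add x y _ _ hx hy => rw [map_add, map_add, add_add_add_comm, hx, hy]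
  | smul a x _ hx => rw [map_smul, map_smul, ← smul_add, hx]

/-- projecting an element of `Sp Q` lands in `Sp (P ∧ Q)`. -/
lemma proj_mem_and {P Q : Finset I → Prop} [DecidablePred P] {v : HT K I} (hv : v ∈ Sp K Q) :
    proj (K := K) P v ∈ Sp K (fun s => Q s ∧ P s) := by
  induction hv using Submodule.span_induction with
  | mem x hx =>
    obtain ⟨s, hs, rfl⟩ := hx
    rw [proj_B]
    split_ifs with h
    · exact B_mem_Sp ⟨hs, h⟩
    · exact Submodule.zero_mem _
  | zero => rw [map_zero]; exact Submodule.zero_mem _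
  | add x y _ _ hx hy => rw [map_add]; exact Submodule.add_mem _ hx hy
  | smul a x _ hx => rw [map_smul]; exact Submodule.smul_mem _ _ hx

/-- `dim Sp P` = the number of `P`-sets. -/
lemma finrank_Sp (P : Finset I → Prop) [DecidablePred P] :
    Module.finrank K (Sp K P) = (Finset.univ.filter P).card := by
  have h1 : Sp K P = Submodule.span K (Set.range fun s : {s : Finset I // P s} => B K I s.1) := by
    rw [Sp]
    congr 1
    ext x
    simp only [Set.mem_image, Set.mem_setOf_eq, Set.mem_range, Subtype.exists, exists_prop]
  have h2 : LinearIndependent K fun s : {s : Finset I // P s} => B K I s.1 :=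
    (B K I).linearIndependent.comp _ Subtype.val_injective
  rw [h1, finrank_span_eq_card h2, Fintype.card_subtype]

/-- **independent sum:** submodules sitting inside spans of pairwise disjoint monomial families add their dimensions. -/
lemma finrank_biSup_eq_sum {ι : Type*} [DecidableEq ι] (S : Finset ι) (A : ι → Submodule K (HT K I))
    (R : ι → Finset I → Prop) (hA : ∀ i ∈ S, A i ≤ Sp K (R i))
    (hR : ∀ i ∈ S, ∀ j ∈ S, i ≠ j → ∀ s, R i s → ¬ R j s) :
    Module.finrank K ↥(⨆ i ∈ S, A i) = ∑ i ∈ S, Module.finrank K (A i) := by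
  induction S using Finset.induction_on with
  | empty => simp
  | insert a S haS ih =>
    rw [Finset.iSup_insert, Finset.sum_insert haS]
    have hA' : ∀ i ∈ S, A i ≤ Sp K (R i) := fun i hi => hA i (Finset.mem_insert_of_mem hi)
    have hR' : ∀ i ∈ S, ∀ j ∈ S, i ≠ j → ∀ s, R i s → ¬ R j s := fun i hi j hj =>
      hR i (Finset.mem_insert_of_mem hi) j (Finset.mem_insert_of_mem hj)
    have hrest : (⨆ i ∈ S, A i) ≤ Sp K (fun s => ∃ i ∈ S, R i s) := by
      refine iSup₂_le fun i hi => (hA' i hi).trans (Sp_mono fun s hs => ⟨i, hi, hs⟩)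
    have hinf : A a ⊓ (⨆ i ∈ S, A i) = ⊥ := by
      rw [eq_bot_iff]
      calc A a ⊓ (⨆ i ∈ S, A i) ≤ Sp K (R a) ⊓ Sp K (fun s => ∃ i ∈ S, R i s) :=
            inf_le_inf (hA a (Finset.mem_insert_self a S)) hrest
        _ = ⊥ := Sp_inf_Sp_eq_bot fun s hs ⟨i, hi, his⟩ =>
            hR a (Finset.mem_insert_self a S) i (Finset.mem_insert_of_mem hi)
              (fun h => haS (h ▸ hi)) s hs his
    have h := Submodule.finrank_sup_add_finrank_inf_eq (A a) (⨆ i ∈ S, A i)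
    rw [hinf, finrank_bot, add_zero] at h
    rw [h, ih hA' hR']

end SpanInfra

end Summit.Ventures.HSemireg.Wedge.Weil
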